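import Mathlib.Analysis.SpecialFunctions.Pow.Real
import Mathlib.Analysis.SpecificLimits.Basic
import Mathlib.Topology.Algebra.InfiniteSum.ENNReal
import Mathlib.Data.Set.Card
import HarnessLib

/-!
# Dyadic summation over sets with polynomial counting functions

Topic `NumberTheory/Automorphic`; namespace `Literature.NumberTheory.Automorphic`. An elementary
summation lemma of the geometry of numbers, isolated for the convergence of the mirabolic
Eisenstein series of `GL_n` in its half-plane of absolute convergence (`MirabolicEisensteinSeries`,
named fact `summable_mirabolicEisenstein`; Jacquet–Shalika, *On Euler products and the
classification of automorphic representations I*, Amer. J. Math. **103** (1981), §4; Cogdell,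
*Analytic theory of L-functions for GL_n* (2004), §2.3: "This is absolutely convergent for
`Re(s) > 1`"), where it bounds the theta-type sums `∑_{ξ ∈ Kⁿ ∖ 0} |Φ(a ξ g)|` over the rational
vectors: if a set `Λ` carries a size function `N ≥ m₀ > 0` whose counting function is polynomial,
`#{ξ ∈ Λ : N ξ ≤ R} ≤ C₀ max(1, R)^D`, then `∑_{ξ ∈ Λ} N(ξ)^{-θ} < ∞` for every `θ > D`
(`tsum_rpow_neg_lt_top_of_ncard_le`: decompose dyadically in `N` (layers `dyadicLayer_subset` …), `#{2^k m₀ ≤ N ≤ 2^{k+1} m₀} ≤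
C₀ (2^{k+1} m₀ ⊔ 1)^D` against the value `(2^k m₀)^{-θ}`, a geometric series of ratio `2^{D-θ}`),
together with the interpolation inequality `(1 + t)^{-κ} ≤ t^{-θ}` (`0 ≤ θ ≤ κ`, `t > 0`) by which a
Schwartz decay `(1 + r N)^{-κ}` is traded for the homogeneous weight `r^{-θ} N^{-θ}`
(`one_add_mul_rpow_neg_le`). Everything is stated in `ℝ≥0∞` (unconditional sums of non-negative
terms), as consumed by the Tonelli-type estimates downstream; pure real analysis, Mathlib only.

## References

* J. W. S. Cassels, *An Introduction to the Geometry of Numbers* (1959), Ch. VI (lattice point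
  counting and convergence of `∑ |x|^{-s}` over lattices). [folklore]
-/

noncomputable section

open scoped ENNReal
open Set Filter

namespace Literature.NumberTheory.Automorphic

/-! ### The interpolation inequality -/

/-- **Trading decay for homogeneity**: `(1 + t)^{-κ} ≤ t^{-θ}` for `t > 0` and `0 ≤ θ ≤ κ`
(`t^θ ≤ (1+t)^θ ≤ (1+t)^κ`). [folklore] -/
theorem one_add_rpow_neg_le_rpow_neg {t θ κ : ℝ} (ht : 0 < t) (hθ : 0 ≤ θ) (hθκ : θ ≤ κ) :
    (1 + t) ^ (-κ) ≤ t ^ (-θ) := by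
  have h1 : (1 : ℝ) ≤ 1 + t := by linarith
  rw [Real.rpow_neg ht.le, Real.rpow_neg (by linarith)]
  refine inv_anti₀ (Real.rpow_pos_of_pos ht θ) ?_
  calc t ^ θ ≤ (1 + t) ^ θ := Real.rpow_le_rpow ht.le (by linarith) hθ
    _ ≤ (1 + t) ^ κ := Real.rpow_le_rpow_of_exponent_le h1 hθκ

/-- The same with a scale: `(1 + r t)^{-κ} ≤ r^{-θ} t^{-θ}` for `r, t > 0`, `0 ≤ θ ≤ κ`. [folklore] -/
theorem one_add_mul_rpow_neg_le {r t θ κ : ℝ} (hr : 0 < r) (ht : 0 < t) (hθ : 0 ≤ θ) (hθκ : θ ≤ κ) :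
    (1 + r * t) ^ (-κ) ≤ r ^ (-θ) * t ^ (-θ) := by
  rw [← Real.mul_rpow hr.le ht.le]
  exact one_add_rpow_neg_le_rpow_neg (mul_pos hr ht) hθ hθκ

/-! ### The dyadic summation lemma -/

section Dyadic

variable {ι : Type*}

/-- The dyadic layers cover a set on which `N ≥ m₀ > 0`. [folklore] -/
theorem subset_iUnion_dyadicLayer {Λ : Set ι} {N : ι → ℝ} {m₀ : ℝ} (hm₀ : 0 < m₀)
    (hmin : ∀ ξ ∈ Λ, m₀ ≤ N ξ) : Λ ⊆ ⋃ k : ℕ, {ξ ∈ Λ | 2 ^ k * m₀ ≤ N ξ ∧ N ξ ≤ 2 ^ (k + 1) * m₀} := by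
  intro ξ hξ
  have hx : 1 ≤ N ξ / m₀ := by rw [le_div_iff₀ hm₀, one_mul]; exact hmin ξ hξ
  obtain ⟨k, hk1, hk2⟩ := exists_nat_pow_near hx one_lt_two
  refine Set.mem_iUnion.2 ⟨k, hξ, ?_, ?_⟩
  · rwa [le_div_iff₀ hm₀] at hk1
  · exact (le_of_lt ((div_lt_iff₀ hm₀).1 hk2))

/-- A dyadic layer lies in the ball `{N ≤ 2^{k+1} m₀}`. [folklore] -/
theorem dyadicLayer_subset (Λ : Set ι) (N : ι → ℝ) (m₀ : ℝ) (k : ℕ) :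
    {ξ ∈ Λ | 2 ^ k * m₀ ≤ N ξ ∧ N ξ ≤ 2 ^ (k + 1) * m₀} ⊆ {ξ ∈ Λ | N ξ ≤ 2 ^ (k + 1) * m₀} :=
  fun _ h => ⟨h.1, h.2.2⟩

/-- On the `k`-th dyadic layer, `N^{-θ} ≤ (2^k m₀)^{-θ}` (`θ ≥ 0`). [folklore] -/
theorem rpow_neg_le_of_mem_dyadicLayer {Λ : Set ι} {N : ι → ℝ} {m₀ : ℝ} (hm₀ : 0 < m₀) {k : ℕ}
    {θ : ℝ} (hθ : 0 ≤ θ) {ξ : ι} (hξ : ξ ∈ {ξ ∈ Λ | 2 ^ k * m₀ ≤ N ξ ∧ N ξ ≤ 2 ^ (k + 1) * m₀}) :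
    N ξ ^ (-θ) ≤ (2 ^ k * m₀) ^ (-θ) := by
  have hpos : 0 < (2 : ℝ) ^ k * m₀ := by positivity
  exact Real.rpow_le_rpow_of_nonpos hpos hξ.2.1 (by linarith)

/-- **The sum over one dyadic layer**: if `#{ξ ∈ Λ : N ξ ≤ R} ≤ C₀ max(1, R)^D` for `R > 0`, then
`∑_{ξ ∈ layer k} N(ξ)^{-θ} ≤ C₀ max(1, 2^{k+1} m₀)^D · (2^k m₀)^{-θ}`. [folklore] -/
theorem tsum_dyadicLayer_le {Λ : Set ι} {N : ι → ℝ} {C₀ D m₀ : ℝ} (hm₀ : 0 < m₀) (hC₀ : 0 ≤ C₀)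
    (hcount : ∀ R : ℝ, 0 < R → {ξ ∈ Λ | N ξ ≤ R}.Finite ∧
      (({ξ ∈ Λ | N ξ ≤ R}.ncard : ℕ) : ℝ) ≤ C₀ * max 1 R ^ D)
    {θ : ℝ} (hθ : 0 ≤ θ) (k : ℕ) :
    ∑' ξ : {ξ ∈ Λ | 2 ^ k * m₀ ≤ N ξ ∧ N ξ ≤ 2 ^ (k + 1) * m₀}, ENNReal.ofReal (N ξ ^ (-θ)) ≤
      ENNReal.ofReal (C₀ * max 1 (2 ^ (k + 1) * m₀) ^ D * (2 ^ k * m₀) ^ (-θ)) := by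
  have hR : 0 < (2 : ℝ) ^ (k + 1) * m₀ := by positivity
  obtain ⟨hfin, hcard⟩ := hcount _ hR
  have hfinL : {ξ ∈ Λ | 2 ^ k * m₀ ≤ N ξ ∧ N ξ ≤ 2 ^ (k + 1) * m₀}.Finite := hfin.subset (dyadicLayer_subset Λ N m₀ k)
  have hcardL : ({ξ ∈ Λ | 2 ^ k * m₀ ≤ N ξ ∧ N ξ ≤ 2 ^ (k + 1) * m₀}.ncard : ℝ) ≤ C₀ * max 1 (2 ^ (k + 1) * m₀) ^ D :=
    le_trans (by exact_mod_cast Set.ncard_le_ncard (dyadicLayer_subset Λ N m₀ k) hfin) hcard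
  -- the sum over the finite layer is a finite sum, each term at most the value at `2^k m₀`
  set b : ℝ≥0∞ := ENNReal.ofReal ((2 ^ k * m₀) ^ (-θ)) with hb
  set L : Set ι := {ξ ∈ Λ | 2 ^ k * m₀ ≤ N ξ ∧ N ξ ≤ 2 ^ (k + 1) * m₀} with hL
  have hcardF : (hfinL.toFinset.card : ℝ) ≤ C₀ * max 1 (2 ^ (k + 1) * m₀) ^ D := by
    rw [← Set.ncard_eq_toFinset_card L hfinL]
    exact hcardL
  have key : ∑' ξ : L, ENNReal.ofReal (N ξ ^ (-θ)) ≤ (hfinL.toFinset.card : ℝ≥0∞) * b := by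
    rw [tsum_subtype L (fun ξ => ENNReal.ofReal (N ξ ^ (-θ))),
      tsum_eq_sum (s := hfinL.toFinset) (fun x hx =>
        Set.indicator_of_notMem (fun h => hx (hfinL.mem_toFinset.2 h)) _)]
    calc ∑ x ∈ hfinL.toFinset, L.indicator (fun ξ => ENNReal.ofReal (N ξ ^ (-θ))) x
        ≤ ∑ _x ∈ hfinL.toFinset, b := Finset.sum_le_sum fun x hx => by
          have hxL : x ∈ L := hfinL.mem_toFinset.1 hx
          rw [Set.indicator_of_mem hxL]
          exact ENNReal.ofReal_le_ofReal (rpow_neg_le_of_mem_dyadicLayer hm₀ hθ hxL)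
      _ = (hfinL.toFinset.card : ℝ≥0∞) * b := by rw [Finset.sum_const, nsmul_eq_mul]
  calc ∑' ξ : L, ENNReal.ofReal (N ξ ^ (-θ)) ≤ (hfinL.toFinset.card : ℝ≥0∞) * b := key
    _ ≤ ENNReal.ofReal (C₀ * max 1 (2 ^ (k + 1) * m₀) ^ D) * b := by
        gcongr
        rw [← ENNReal.ofReal_natCast]
        exact ENNReal.ofReal_le_ofReal hcardF
    _ = ENNReal.ofReal (C₀ * max 1 (2 ^ (k + 1) * m₀) ^ D * (2 ^ k * m₀) ^ (-θ)) := by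
        rw [hb, ← ENNReal.ofReal_mul (by positivity)]


/-- The geometric majorant of the dyadic layer bounds: for `k ∈ ℕ`,
`C₀ max(1, 2^{k+1} m₀)^D (2^k m₀)^{-θ} ≤ (C₀ max(1, 2 m₀)^D m₀^{-θ}) · (2^{D-θ})^k` (`D, θ ≥ 0`). [folklore] -/
theorem dyadicLayer_bound_le_geometric {C₀ D m₀ θ : ℝ} (hC₀ : 0 ≤ C₀) (hD : 0 ≤ D) (hm₀ : 0 < m₀)
    (k : ℕ) :
    C₀ * max 1 (2 ^ (k + 1) * m₀) ^ D * (2 ^ k * m₀) ^ (-θ) ≤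
      C₀ * max 1 (2 * m₀) ^ D * m₀ ^ (-θ) * ((2 : ℝ) ^ (D - θ)) ^ k := by
  have h2k : (1 : ℝ) ≤ 2 ^ k := one_le_pow₀ one_le_two
  have h2k0 : (0 : ℝ) < 2 ^ k := by positivity
  -- `max 1 (2^{k+1} m₀) ≤ 2^k · max 1 (2 m₀)`
  have hmax : max 1 (2 ^ (k + 1) * m₀) ≤ 2 ^ k * max 1 (2 * m₀) := by
    refine max_le ?_ ?_
    · calc (1 : ℝ) = 1 * 1 := (mul_one 1).symm
        _ ≤ 2 ^ k * max 1 (2 * m₀) := mul_le_mul h2k (le_max_left _ _) zero_le_one h2k0.le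
    · rw [pow_succ, mul_assoc]
      exact mul_le_mul_of_nonneg_left (le_max_right _ _) h2k0.le
  have hmaxD : max 1 (2 ^ (k + 1) * m₀) ^ D ≤ (2 ^ k) ^ D * max 1 (2 * m₀) ^ D := by
    rw [← Real.mul_rpow h2k0.le (le_trans zero_le_one (le_max_left _ _))]
    exact Real.rpow_le_rpow (le_trans zero_le_one (le_max_left _ _)) hmax hD
  have hpow : (2 ^ k * m₀) ^ (-θ) = (2 ^ k) ^ (-θ) * m₀ ^ (-θ) := Real.mul_rpow h2k0.le hm₀.le
  have hgeom : ((2 : ℝ) ^ k) ^ D * (2 ^ k) ^ (-θ) = ((2 : ℝ) ^ (D - θ)) ^ k := by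
    rw [← Real.rpow_add h2k0, ← Real.rpow_natCast, ← Real.rpow_natCast, ← Real.rpow_mul zero_le_two,
      ← Real.rpow_mul zero_le_two, mul_comm (k : ℝ)]
    ring_nf
  calc C₀ * max 1 (2 ^ (k + 1) * m₀) ^ D * (2 ^ k * m₀) ^ (-θ)
      ≤ C₀ * ((2 ^ k) ^ D * max 1 (2 * m₀) ^ D) * ((2 ^ k) ^ (-θ) * m₀ ^ (-θ)) := by
        rw [hpow]
        gcongr
    _ = C₀ * max 1 (2 * m₀) ^ D * m₀ ^ (-θ) * ((2 ^ k) ^ D * (2 ^ k) ^ (-θ)) := by ring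
    _ = C₀ * max 1 (2 * m₀) ^ D * m₀ ^ (-θ) * ((2 : ℝ) ^ (D - θ)) ^ k := by rw [hgeom]

/-- **The dyadic summation lemma.** Let `Λ` be a set with a size function `N` such that
`N ≥ m₀ > 0` on `Λ` and `#{ξ ∈ Λ : N ξ ≤ R} ≤ C₀ max(1, R)^D` for all `R > 0` (finite). Then for
every `θ > D ≥ 0`, `∑_{ξ ∈ Λ} N(ξ)^{-θ} < ∞`: cover `Λ` by the dyadic layers `2^k m₀ ≤ N ≤ 2^{k+1} m₀`,
bound each by `tsum_dyadicLayer_le`, and sum the geometric series of ratio `2^{D-θ} < 1`. This is the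
convergence of `∑_{x ∈ L ∖ 0} |x|^{-θ}` (`θ > rank L`) over a lattice `L`, in the form needed for the
rational vectors `Kⁿ ⊂ 𝔸_Kⁿ`. [folklore] -/
theorem tsum_rpow_neg_lt_top_of_ncard_le {ι : Type*} {Λ : Set ι} {N : ι → ℝ} {C₀ D m₀ : ℝ}
    (hm₀ : 0 < m₀) (hC₀ : 0 ≤ C₀) (hD : 0 ≤ D) (hmin : ∀ ξ ∈ Λ, m₀ ≤ N ξ)
    (hcount : ∀ R : ℝ, 0 < R → {ξ ∈ Λ | N ξ ≤ R}.Finite ∧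
      (({ξ ∈ Λ | N ξ ≤ R}.ncard : ℕ) : ℝ) ≤ C₀ * max 1 R ^ D)
    {θ : ℝ} (hθ : D < θ) :
    ∑' ξ : Λ, ENNReal.ofReal (N ξ ^ (-θ)) < ⊤ := by
  have hθ0 : 0 ≤ θ := hD.trans hθ.le
  set a : ℕ → ℝ := fun k => C₀ * max 1 (2 ^ (k + 1) * m₀) ^ D * (2 ^ k * m₀) ^ (-θ) with ha
  have ha0 : ∀ k, 0 ≤ a k := fun k => by positivity
  -- the majorant series is summable (geometric)
  have hq : (2 : ℝ) ^ (D - θ) < 1 := Real.rpow_lt_one_of_one_lt_of_neg one_lt_two (by linarith)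
  have hq0 : 0 ≤ (2 : ℝ) ^ (D - θ) := Real.rpow_nonneg zero_le_two _
  have hsum : Summable a := by
    refine Summable.of_nonneg_of_le ha0 (fun k => dyadicLayer_bound_le_geometric hC₀ hD hm₀ k) ?_
    exact (summable_geometric_of_lt_one hq0 hq).mul_left _
  -- cover by layers and sum
  calc ∑' ξ : Λ, ENNReal.ofReal (N ξ ^ (-θ))
      ≤ ∑' ξ : ⋃ k : ℕ, {ξ ∈ Λ | 2 ^ k * m₀ ≤ N ξ ∧ N ξ ≤ 2 ^ (k + 1) * m₀}, ENNReal.ofReal (N ξ ^ (-θ)) :=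
        ENNReal.tsum_mono_subtype (fun ξ => ENNReal.ofReal (N ξ ^ (-θ)))
          (subset_iUnion_dyadicLayer hm₀ hmin)
    _ ≤ ∑' k : ℕ, ∑' ξ : {ξ ∈ Λ | 2 ^ k * m₀ ≤ N ξ ∧ N ξ ≤ 2 ^ (k + 1) * m₀}, ENNReal.ofReal (N ξ ^ (-θ)) :=
        ENNReal.tsum_iUnion_le_tsum (fun ξ => ENNReal.ofReal (N ξ ^ (-θ)))
          fun k : ℕ => {ξ ∈ Λ | 2 ^ k * m₀ ≤ N ξ ∧ N ξ ≤ 2 ^ (k + 1) * m₀}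
    _ ≤ ∑' k, ENNReal.ofReal (a k) :=
        ENNReal.tsum_le_tsum fun k => tsum_dyadicLayer_le hm₀ hC₀ hcount hθ0 k
    _ = ENNReal.ofReal (∑' k, a k) := (ENNReal.ofReal_tsum_of_nonneg ha0 hsum).symm
    _ < ⊤ := ENNReal.ofReal_lt_top

end Dyadic

end Literature.NumberTheory.Automorphic
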